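import Summits.Schanuel.Schanuel.Theorems.ZilberEacRealHyperplaneFastExamples
import Literature.ModelTheory.Zilber.EAC
import HarnessLib

/-!
# Moving targets over real hyperplanes ARE members of the open cell; one of them is now solved

Zilber's Exponential-Algebraic Closedness, case ladder (host summit Schanuel, cell `pub-schanuel`,
seat 2, gen 8).  Seat 1's certificate `ecCell_hypotheses_polyFibredGraph` (EACRotundityProofs §4)
covers the graph-base families `polyFibredGraph g A F` only for `deg g ≥ 2` (additive freeness from
"a linear relation would make `g` affine").  The real-HYPERPLANE bases of THEOREMS R / R⁺ / R⁺⁺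
(`g = Σ rᵢ Xᵢ + c`, `rᵢ ∈ ℝ`) are affine, and the missing ingredient is

* `isAddFree_of_vanishingIdeal_projAdd_eq_ker_linear`: if `I(π(V)) = ker (X_{s+1} ↦ g)` with
  `g = Σ rᵢ Xᵢ + c` and SOME `rᵢ` irrational, then `V` is additively free (an integer relation
  `Σ mᵢ xᵢ + m_{s+1} x_{s+1} = const` on `V` forces `mᵢ + m_{s+1} rᵢ = 0`, hence `rᵢ ∈ ℚ` or `m = 0`).

Hence (`ecCell_hypotheses_polyFibredGraph_hyperplane`): for `A` dominant and some `rᵢ ∉ ℚ` the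
`(s+2)`-fold `polyFibredGraph (Σ rᵢXᵢ + c) A F = {x_{s+2} = Σ rᵢxᵢ + c, yⱼ = Aⱼ(x) + y F_j(y, x)}`
satisfies ALL SEVEN hypotheses of `ECCell (s+2) (s+1)` (and is not linearly split) — so these are
genuine members of the OPEN cells, in particular of `EC(3,2)` for `s + 1 = 2`, and
`ECCell (s+2) (s+1)` would solve all of them (`…_inter_expGraph_nonempty_of_ecCell`).

**A certified member of `EC(3,2)` solved by THEOREM R⁺⁺**
(`sqrt_two_sqrt_three_mixed_member_solved`): `W = {x₃ = √2x₁ + √3x₂, y₁ = x₁ + y₃², y₂ = x₂ + y₃}`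
satisfies all seven hypotheses of `ECCell 3 2`, is not linearly split, and `W ∩ Γ_exp ≠ ∅` — by
`sqrt_two_sqrt_three_mixed_system_solvable`, where THEOREMS R/R⁺ do not apply.

HONEST FRAMING: certified instances of an OPEN cell; `EC(3,2)` itself OPEN; NOT Schanuel's
conjecture; EAC ⇏ SC.
-/

noncomputable section

open Complex MvPolynomial Filter Topology
open Literature.NumberTheory.Transcendental Literature.ModelTheory.Zilber

set_option linter.dupNamespace false

namespace Summit.Schanuel.Schanuel.Theorems

section Hyperplane

variable {s : ℕ}

/-- The real hyperplane base `Σᵢ rᵢ Xᵢ + c ∈ ℂ[X₀, …, X_s]`. [folklore] -/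
def hyperplanePoly (r : Fin (s + 1) → ℝ) (c : ℂ) : MvPolynomial (Fin (s + 1)) ℂ :=
  ∑ i, C (r i : ℂ) * X i + C c

/-- `eval x (Σ rᵢ Xᵢ + c) = ℓ(x)`. [folklore] -/
theorem eval_hyperplanePoly (r : Fin (s + 1) → ℝ) (c : ℂ) (x : Fin (s + 1) → ℂ) :
    eval x (hyperplanePoly r c) = ell r c x := by
  simp only [hyperplanePoly, ell, map_add, map_sum, map_mul, eval_C, eval_X]

/-- The `Xᵢ`-coefficient of a linear form. [folklore] -/
theorem coeff_single_one_linearForm {n : ℕ} (l : Fin n → ℂ) (l₀ : ℂ) (i : Fin n) :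
    coeff (Finsupp.single i 1) (∑ j, C (l j) * X j + C l₀ : MvPolynomial (Fin n) ℂ) = l i := by
  classical
  rw [coeff_add, coeff_sum, coeff_C, if_neg (by
    intro h
    have := congrArg (fun f => f i) h
    simp at this)]
  rw [Finset.sum_eq_single i]
  · rw [coeff_C_mul, coeff_X, if_pos rfl, mul_one, add_zero]
  · intro j _ hji
    rw [coeff_C_mul, coeff_X, if_neg, mul_zero]
    intro h
    exact hji (Finsupp.single_left_injective one_ne_zero h)
  · intro h; exact absurd (Finset.mem_univ i) h

/-- **Additive freeness over a hyperplane with an irrational coefficient.**  If the additive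
projection of `V ⊆ ℂ^{s+2} × ℂ^{s+2}` has vanishing ideal `ker (X_{s+2} ↦ Σ rᵢ Xᵢ + c)` and some
`rᵢ ∉ ℚ`, then `V` is additively free: a relation `Σ mᵢ xᵢ = const` gives
`Σ_{i≤s} mᵢ Xᵢ + m_{s+1}(Σ rᵢXᵢ + c) = const` in `ℂ[X]`, whose `Xᵢ`-coefficients `mᵢ + m_{s+1} rᵢ`
vanish. [folklore] -/
theorem isAddFree_of_vanishingIdeal_projAdd_eq_ker_linear {V : Set (Fin (s + 2) ⊕ Fin (s + 2) → ℂ)}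
    (r : Fin (s + 1) → ℝ) (c : ℂ)
    (hV : vanishingIdeal ℂ (projAdd '' V) = RingHom.ker (aeval (graphSubst (hyperplanePoly r c)) :
        MvPolynomial (Fin (s + 2)) ℂ →ₐ[ℂ] MvPolynomial (Fin (s + 1)) ℂ))
    (hirr : ∃ i, Irrational (r i)) : IsAddFree ℂ (s + 2) V := by
  classical
  rintro m hm ⟨c', hc'⟩
  let L : MvPolynomial (Fin (s + 2)) ℂ := (∑ i, C ((m i : ℤ) : ℂ) * X i) - C c'
  have hL : L ∈ vanishingIdeal ℂ (projAdd '' V) := by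
    rw [mem_vanishingIdeal_iff]
    rintro _ ⟨z, hz, rfl⟩
    have := hc' z hz
    simp only [L, map_sub, map_sum, map_mul, aeval_C, aeval_X, projAdd_apply, sub_eq_zero]
    simpa using this
  rw [hV, RingHom.mem_ker] at hL
  have hτ : aeval (graphSubst (hyperplanePoly r c)) L =
      (∑ j : Fin (s + 1), C ((m (Fin.castSucc j) : ℤ) : ℂ) * X j) +
        C ((m (Fin.last (s + 1)) : ℤ) : ℂ) * hyperplanePoly r c - C c' := by
    simp only [L, map_sub, map_add, map_sum, map_mul, aeval_C, aeval_X, algebraMap_eq,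
      Fin.sum_univ_castSucc, graphSubst, Fin.snoc_castSucc, Fin.snoc_last]
  rw [hτ] at hL
  -- the `Xᵢ`-coefficients: `mᵢ + m_last rᵢ = 0`
  have hcoef : ∀ i : Fin (s + 1),
      ((m (Fin.castSucc i) : ℤ) : ℂ) + ((m (Fin.last (s + 1)) : ℤ) : ℂ) * (r i : ℂ) = 0 := by
    intro i
    have h := congrArg (coeff (Finsupp.single i 1)) hL
    rw [coeff_zero, coeff_sub, coeff_add, coeff_C_mul, hyperplanePoly, coeff_single_one_linearForm,
      coeff_C, if_neg (by
        intro h0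
        have := congrArg (fun f => f i) h0
        simp at this), sub_zero] at h
    have h2 : coeff (Finsupp.single i 1) (∑ j : Fin (s + 1), C ((m (Fin.castSucc j) : ℤ) : ℂ) * X j :
        MvPolynomial (Fin (s + 1)) ℂ) = ((m (Fin.castSucc i) : ℤ) : ℂ) := by
      have := coeff_single_one_linearForm (fun j : Fin (s + 1) => ((m (Fin.castSucc j) : ℤ) : ℂ)) 0 i
      rwa [map_zero, add_zero] at this
    rw [h2] at h
    exact h
  by_cases hlast : m (Fin.last (s + 1)) = 0
  · apply hm
    funext i
    induction i using Fin.lastCases with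
    | last => exact hlast
    | cast j =>
      have h := hcoef j
      rw [hlast, Int.cast_zero, zero_mul, add_zero] at h
      exact_mod_cast h
  · obtain ⟨i, hi⟩ := hirr
    have h := hcoef i
    have hml : ((m (Fin.last (s + 1)) : ℤ) : ℝ) ≠ 0 := by exact_mod_cast hlast
    have hreal : ((m (Fin.castSucc i) : ℤ) : ℝ) + ((m (Fin.last (s + 1)) : ℤ) : ℝ) * r i = 0 := by
      have := congrArg Complex.re h
      simpa using this
    apply hi
    refine ⟨-((m (Fin.castSucc i) : ℤ) : ℚ) / (m (Fin.last (s + 1)) : ℤ), ?_⟩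
    push_cast
    field_simp
    linarith

/-- **Cell membership over a real hyperplane base.**  For `A` dominant and some `rᵢ` irrational the
`(s+2)`-fold `polyFibredGraph (Σ rᵢXᵢ + c) A F` satisfies all seven hypotheses of
`ECCell (s+2) (s+1)`. [folklore] -/
theorem ecCell_hypotheses_polyFibredGraph_hyperplane (r : Fin (s + 1) → ℝ) (c : ℂ)
    (A : Fin (s + 1) → MvPolynomial (Fin (s + 1)) ℂ) (F : Fin (s + 1) → MvPolynomial (Fin (s + 2)) ℂ)
    (hA : Function.Injective (aeval A : MvPolynomial (Fin (s + 1)) ℂ →ₐ[ℂ] MvPolynomial (Fin (s + 1)) ℂ))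
    (hirr : ∃ i, Irrational (r i)) :
    IsIrreducibleClosed ℂ (polyFibredGraph (hyperplanePoly r c) A F) ∧
    (polyFibredGraph (hyperplanePoly r c) A F ∩ torusLocus ℂ (s + 2)).Nonempty ∧
    IsRotund ℂ (s + 2) (polyFibredGraph (hyperplanePoly r c) A F ∩ torusLocus ℂ (s + 2)) ∧
    IsAddFree ℂ (s + 2) (polyFibredGraph (hyperplanePoly r c) A F ∩ torusLocus ℂ (s + 2)) ∧
    IsMulFree ℂ (s + 2) (polyFibredGraph (hyperplanePoly r c) A F ∩ torusLocus ℂ (s + 2)) ∧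
    zariskiDim ℂ (polyFibredGraph (hyperplanePoly r c) A F) = (s + 2 : ℕ) ∧
    addProjDim ℂ (s + 2) (polyFibredGraph (hyperplanePoly r c) A F) = (s + 1 : ℕ) :=
  ⟨isIrreducibleClosed_polyFibredGraph _ _ _, polyFibredGraph_inter_torusLocus_nonempty _ _ _ hA,
    isRotund_polyFibredGraph _ _ _ hA,
    isAddFree_of_vanishingIdeal_projAdd_eq_ker_linear r c
      (vanishingIdeal_projAdd_polyFibredGraph _ _ _ hA) hirr,
    isMulFree_polyFibredGraph _ _ _ hA, zariskiDim_polyFibredGraph _ _ _,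
    addProjDim_polyFibredGraph _ _ _ hA⟩

/-- Hence `ECCell (s+2) (s+1)` would give every such variety an exponential point — they are
genuine members of the open cells (`EC(3,2)` for `s = 1`). [folklore] -/
theorem polyFibredGraph_hyperplane_inter_expGraph_nonempty_of_ecCell (r : Fin (s + 1) → ℝ) (c : ℂ)
    (A : Fin (s + 1) → MvPolynomial (Fin (s + 1)) ℂ) (F : Fin (s + 1) → MvPolynomial (Fin (s + 2)) ℂ)
    (hA : Function.Injective (aeval A : MvPolynomial (Fin (s + 1)) ℂ →ₐ[ℂ] MvPolynomial (Fin (s + 1)) ℂ))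
    (hirr : ∃ i, Irrational (r i)) (h : ECCell (s + 2) (s + 1)) :
    (polyFibredGraph (hyperplanePoly r c) A F ∩ expGraph ℂ (s + 2)).Nonempty := by
  obtain ⟨h1, h2, h3, h4, h5, h6, h7⟩ := ecCell_hypotheses_polyFibredGraph_hyperplane r c A F hA hirr
  exact h _ h1 h2 h3 h4 h5 h6 h7

end Hyperplane

/-! ## A certified member of `EC(3,2)` solved by THEOREM R⁺⁺ -/

section Solved

/-- The 3-fold `W₂₃ = {x₃ = √2x₁ + √3x₂, y₁ = x₁ + y₃·y₃, y₂ = x₂ + y₃·1}` as a `polyFibredGraph`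
(fibre polynomials `F₀(u, x) = u`, `F₁ = 1`). [cite: MantovaMasser2023, §1 p.5 (the open case dim π(V) = 2 in ℂ³×ℂˣ³)] -/
def sqrtTwoSqrtThreeMixed : Set (Fin 3 ⊕ Fin 3 → ℂ) :=
  polyFibredGraph (hyperplanePoly ![Real.sqrt 2, Real.sqrt 3] 0) (fun j => X j) ![X 0, 1]

/-- **A certified member of the open cell `EC(3,2)`, solved.**  `W₂₃` satisfies all seven hypotheses
of `ECCell 3 2`, is not linearly split (non-split part of the cell), and `W₂₃ ∩ Γ_exp ≠ ∅`
unconditionally — the exponential points being the solutions of `e^{z} = z + e^{2(√2z+√3w)}`,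
`e^{w} = w + e^{√2z+√3w}` provided by THEOREM R⁺⁺ (`sqrt_two_sqrt_three_mixed_system_solvable`).
(new) [cite: MantovaMasser2023, §1 p.5 (the open case dim π(V) = 2 in ℂ³×ℂˣ³)] -/
theorem sqrt_two_sqrt_three_mixed_member_solved :
    (IsIrreducibleClosed ℂ sqrtTwoSqrtThreeMixed ∧
      (sqrtTwoSqrtThreeMixed ∩ torusLocus ℂ 3).Nonempty ∧
      IsRotund ℂ 3 (sqrtTwoSqrtThreeMixed ∩ torusLocus ℂ 3) ∧
      IsAddFree ℂ 3 (sqrtTwoSqrtThreeMixed ∩ torusLocus ℂ 3) ∧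
      IsMulFree ℂ 3 (sqrtTwoSqrtThreeMixed ∩ torusLocus ℂ 3) ∧
      zariskiDim ℂ sqrtTwoSqrtThreeMixed = (3 : ℕ) ∧
      addProjDim ℂ 3 sqrtTwoSqrtThreeMixed = (2 : ℕ)) ∧
    ¬ IsLinearSplit ℂ 3 sqrtTwoSqrtThreeMixed ∧
    (sqrtTwoSqrtThreeMixed ∩ expGraph ℂ 3).Nonempty := by
  have hA : Function.Injective (aeval (fun j : Fin 2 => (X j : MvPolynomial (Fin 2) ℂ)) :
      MvPolynomial (Fin 2) ℂ →ₐ[ℂ] MvPolynomial (Fin 2) ℂ) := by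
    rw [aeval_X_left]; exact fun _ _ h => h
  have hirr : ∃ i : Fin 2, Irrational ((![Real.sqrt 2, Real.sqrt 3] : Fin 2 → ℝ) i) :=
    ⟨0, by simpa using irrational_sqrt_two⟩
  refine ⟨ecCell_hypotheses_polyFibredGraph_hyperplane _ 0 _ _ hA hirr,
    not_isLinearSplit_polyFibredGraph _ _ _ (by norm_num) hA, ?_⟩
  rw [sqrtTwoSqrtThreeMixed, polyFibredGraph_inter_expGraph_nonempty_iff]
  obtain ⟨z, w, hz, hw⟩ := sqrt_two_sqrt_three_mixed_system_solvable
  refine ⟨![z, w], ?_⟩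
  have hℓ : eval ![z, w] (hyperplanePoly ![Real.sqrt 2, Real.sqrt 3] 0) =
      (Real.sqrt 2 : ℝ) * z + (Real.sqrt 3 : ℝ) * w := by
    rw [eval_hyperplanePoly, ell, Fin.sum_univ_two]
    simp
  rw [hℓ]
  refine Fin.forall_fin_two.2 ⟨?_, ?_⟩
  · simp only [Matrix.cons_val_zero, eval_X, Fin.cons_zero]
    rw [hz, two_mul, Complex.exp_add]
  · simp only [Matrix.cons_val_one, Matrix.cons_val_fin_one, eval_X, map_one, mul_one]
    exact hw

end Solved

end Summit.Schanuel.Schanuel.Theorems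

end
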